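import Summits.BirchSwinnertonDyer.BirchSwinnertonDyer.Theorems.ResidualThetaTransportAtTwoRlfTwistedEventualLiftOfPoitouTate
import Summits.BirchSwinnertonDyer.BirchSwinnertonDyer.Theorems.ThetaPartnerAtTwoSignedKatoUpToAtTwoPointsModelJTwo
import Summits.BirchSwinnertonDyer.Rank1Residual.X1.LocalKerOverAtPConj
import HarnessLib

/-!
# Road T for item 23110, brick (B2) of «LIFT⁺₂ ⟸ H-PLUSDUAL ∧ H-FIN»: the EVENTUAL Poitou–Tate lifting with prescribed classes AT THE
# PLACES ABOVE `p` MODULO the signed local Kummer condition — the one-place twin of the lead's (D3)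
# `TwistedPT.exists_mem_selmerGroup_signedRelaxed_res_eq_map_incl_of_poitouTate` (prescribed classes at `S₀`)

Route `ResidualThetaTransportAtTwo` (RTT, crux r201 `ResidualLambdaFormulaNegDiscAtTwo`, stmt-BirchSwinnertonDyer-23110) /
`ThetaPartnerAtTwo` (TP2). Seat `prover-bsd-wall-tp2-p2x-w3` g12; `--supports stmt-BirchSwinnertonDyer-23110`. THEOREMS ONLY (no
definition, no named fact, no `sorry`); route-independent; closes nothing.

Greenberg (LNM 1716, §4 p. 124) for the divisible twisted module `M = A_s`: «`H¹(F_Σ/F, M) → 𝒫^{(p)}_M(F)` modulo the local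
condition is surjective when `S_{M*}(F)` is finite and `M*(F) = 0`» — the input (LIFT) of the chase. At finite level this is Howard's
`SelmerComplement` (tree fact `poitouTate_selmerStructure_duality K`, a THEOREM for `K = ℚ`) for the pair of signed structures
`𝓖^A_{S₀} ≤ 𝓖^A_{S₀ ∪ {v ∣ p}}` of `ZpExtensionGaloisTwistSignedSelmerStructure` — NO NEW STRUCTURE: the relaxed signed structure
with the places above `p` thrown into the relaxed set IS «everything at `S`, unramified outside» — with target `H¹(ι) x_v` at `v ∣ p`
and the EVENTUAL level shift `J ↦ J'` killing the obstruction `H¹_{(𝓖^A_{S₀})^*}(K, M_{J'}^D)` through `H¹(ι^D) = 0` on it (tower input).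

* `exists_mem_selmerGroup_relaxed_sub_map_incl_mem_localKummer_of_poitouTate` — any number field `K` with
  `poitouTate_selmerStructure_duality K`, any `p`, `κ`, `u ≡ 1 (p)`, `A`: for every `J` and every family `(x_v)_v`,
  `x_v ∈ H¹(Γ_{K_v}, E[p^J](χ_u))`, a level `J' ≥ J` and `y ∈ H¹_{𝓖^A_{S₀ ∪ {v ∣ p}}}(K, E[p^{J'}](χ_u))` (unramified outside
  `S₀ ∪ {v ∣ p}`) with `res_v y − H¹(ι|_{Γ_{K_v}}) x_v ∈ W.twistedTorsionLocalKummer p κ J' u hu K_v (A v)` at every `v ∣ p`,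
  `v ∉ S₀`, GIVEN the tower input for the dual of `𝓖^A_{S₀}`.
* `tower_relaxed_of_tower_signed` — the tower input for `(𝓖^A_{S₀})^*` from the one for `(𝓕^A_{S₀})^*` (the lead's (D4c)/(D5)
  currency): `𝓕^A ≤ 𝓖^A` ⟹ `H¹_{(𝓖^A)^*} ≤ H¹_{(𝓕^A)^*}` (`selmerGroup_dualSelmerStructure_anti`).
* §2 (`K = ℚ`, cyclotomic `κ`, `v ∋ p`): `conjH1_mem_localKummerOverOfEmb_iSup_signedLocalPoints` — Kobayashi's signed Kummer
  condition over `ℚ_∞` at the place above `p` is stable under EVERY `conj_σ`, `σ ∈ Γ_ℚ` (`Γ_ℚ = res(Γ_{ℚ_v})·ker κ`: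
  `exists_resGal_inv_mul_mem_kerSubgroup`; `conjH1_mem_localKummerOverOfEmb_of_smul_mem`; `⨆ₙ E^ε_n` is `Γ_{ℚ_v}`-stable), and
  `mem_iInf_comap_conjH1_localKummer_of_forall_mem` — so the `⨅_σ` in road T's `K₂⁺` costs nothing.

HONEST FRAMING: closes nothing; 23110 is NOT proved; BSD is not proved by any of this.
References: [GreenbergLNM1716] §4 Prop. 4.13 + Remark (pp. 120–122), p. 124; [Howard2004HeegnerKolyvagin] Thm. 2.1.11;
[Kobayashi2003] Def. 1.1, Prop. 8.12; [SerreLocalFields1979] VII §5 Prop. 3.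
-/

-- the Theorems namespace of this sub repeats the summit name by design (D-0017 nested layout)
set_option linter.dupNamespace false

noncomputable section

open scoped Classical NumberField

open NumberField IsDedekindDomain Field
open Literature.NumberTheory.EllipticCurves Literature.NumberTheory.GaloisRepresentations
  Literature.NumberTheory.GaloisCohomology WeierstrassCurve ZpExtension Literature.NumberTheory.EllipticCurves.Kobayashi2003
  Literature.NumberTheory.EllipticCurves.GreenbergVatsal2000
open Literature.NumberTheory.GaloisRepresentations.DiscreteGaloisModule (localTatePairingZMod unramifiedSubgroup
  SelmerStructure)

universe u

namespace Summit.BirchSwinnertonDyer.BirchSwinnertonDyer.Theorems.SignedEC.TwistedPT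

section General

variable {K : Type u} [Field K] [NumberField K] (W : WeierstrassCurve K) (p : ℕ) [Fact p.Prime]
  (S₀ : Finset (HeightOneSpectrum (𝓞 K))) (κ : ZpExtension K p) (u : ℤ) (hu : (p : ℤ) ∣ u - 1)
  (A : ∀ v : HeightOneSpectrum (𝓞 K), AddSubgroup (localPoints W (v.adicCompletion K)))

/-- `𝓖^A_{S₀} ≤ 𝓖^A_{S₀ ∪ {v ∣ p}}`: relaxing also at the places above `p` enlarges the structure (at `v ∣ p`, `v ∉ S₀` the signed
Kummer condition sits inside everything; elsewhere the two agree). [cite: Howard2004HeegnerKolyvagin, Def. 2.1.10] -/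
theorem twistedSignedRelaxedSelmerStructure_le_union_placesAbove (J : ℕ) :
    W.twistedSignedRelaxedSelmerStructure p S₀ κ J u hu A ≤
      W.twistedSignedRelaxedSelmerStructure p (S₀ ∪ WeierstrassCurve.placesAbove (K := K) p) κ J u hu A := by
  intro v
  cases v with
  | inl w => exact le_rfl
  | inr v =>
    by_cases hv : v ∈ S₀
    · rw [W.twistedSignedRelaxedSelmerStructure_inr_of_mem p _ κ J u hu A (Finset.mem_union_left _ hv)]; exact le_top
    · by_cases hpv : ((p : ℕ) : 𝓞 K) ∈ v.asIdeal
      · rw [W.twistedSignedRelaxedSelmerStructure_inr_of_mem p _ κ J u hu A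
          (Finset.mem_union_right _ ((WeierstrassCurve.mem_placesAbove_iff p v).2 hpv))]
        exact le_top
      · have hv' : v ∉ S₀ ∪ WeierstrassCurve.placesAbove (K := K) p := by
          rw [Finset.mem_union, not_or, WeierstrassCurve.mem_placesAbove_iff]; exact ⟨hv, hpv⟩
        rw [W.twistedSignedRelaxedSelmerStructure_inr_of_not_mem p S₀ κ J u hu A hv hpv,
          W.twistedSignedRelaxedSelmerStructure_inr_of_not_mem p _ κ J u hu A hv' hpv]

/-- `𝓖^A_{S₀ ∪ {v ∣ p}}` is unramified outside `S = S₀ ∪ {v ∣ p} ∪ ∞` (`twistedDescentPlaces p S₀`).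
[cite: Howard2004HeegnerKolyvagin, Def. 2.1.10] -/
theorem isUnramifiedOutside_twistedSignedRelaxedSelmerStructure_union_placesAbove (J : ℕ) :
    (W.twistedSignedRelaxedSelmerStructure p (S₀ ∪ WeierstrassCurve.placesAbove (K := K) p) κ J u hu A).IsUnramifiedOutside
      (twistedDescentPlaces (K := K) p S₀) := by
  refine ⟨inl_mem_twistedDescentPlaces p S₀, fun v hv ↦ ?_⟩
  rw [not_mem_twistedDescentPlaces_iff] at hv
  have hv' : v ∉ S₀ ∪ WeierstrassCurve.placesAbove (K := K) p := by
    rw [Finset.mem_union, not_or, WeierstrassCurve.mem_placesAbove_iff]; exact hv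
  exact W.twistedSignedRelaxedSelmerStructure_inr_of_not_mem p _ κ J u hu A hv' hv.2

/-- **The tower input for `(𝓖^A)^*` from the one for `(𝓕^A)^*`**: `𝓕^A_{S₀} ≤ 𝓖^A_{S₀}` gives
`H¹_{(𝓖^A)^*}(K, M^D) ≤ H¹_{(𝓕^A)^*}(K, M^D)` (`selmerGroup_dualSelmerStructure_anti`), so whatever kills the latter kills the former.
[cite: Howard2004HeegnerKolyvagin, Thm. 2.1.11 (arXiv:1202.6340 p. 6)] -/
theorem tower_relaxed_of_tower_signed [hfin : ∀ J : ℕ, Finite (W.geomTorsion ((p ^ J : ℕ) : ℤ))]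
    (htower : ∀ J : ℕ, ∃ (J' : ℕ) (hJ : J ≤ J'), ∀ inv : LocalInvariants K (p ^ J'), inv.IsPerfect →
      inv.SumLocalTermEqZero → inv.UnramifiedOrthogonal →
      ∀ y ∈ (inv.dualSelmerStructure (W.twistedTorsionGaloisModule p κ J' u hu)
          (W.twistedSignedSelmerStructure p S₀ κ J' u hu A)).selmerGroup,
        galoisCohomology.map (W.twistedTorsionInclDual p κ hJ u hu) 1 y = 0) :
    ∀ J : ℕ, ∃ (J' : ℕ) (hJ : J ≤ J'), ∀ inv : LocalInvariants K (p ^ J'), inv.IsPerfect →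
      inv.SumLocalTermEqZero → inv.UnramifiedOrthogonal →
      ∀ y ∈ (inv.dualSelmerStructure (W.twistedTorsionGaloisModule p κ J' u hu)
          (W.twistedSignedRelaxedSelmerStructure p S₀ κ J' u hu A)).selmerGroup,
        galoisCohomology.map (W.twistedTorsionInclDual p κ hJ u hu) 1 y = 0 := by
  intro J
  obtain ⟨J', hJ, h⟩ := htower J
  exact ⟨J', hJ, fun inv hperf hvan hur y hy ↦ h inv hperf hvan hur y
    (inv.selmerGroup_dualSelmerStructure_anti (W.twistedTorsionGaloisModule p κ J' u hu)
      (W.twistedSignedSelmerStructure_le_relaxed p S₀ κ J' u hu A) hy)⟩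

/-- **The EVENTUAL Poitou–Tate lifting with prescribed classes at the places above `p` modulo the signed local Kummer condition.**
`K` a number field with `poitouTate_selmerStructure_duality K`, `E[p^J]` finite for all `J`, `E[p^J](χ_u)` unramified with `p^J ∉ v`
outside `S = S₀ ∪ {v ∣ p} ∪ ∞` (`hS`), and the tower input `htower` for the dual of the relaxed signed structure `𝓖^A_{S₀}`. Then for
every `J` and every family `(x_v)_v` of local classes of level `J` there are `J' ≥ J` and a class `y` of the Selmer group of
`𝓖^A_{S₀ ∪ {v ∣ p}}` (everything at `S`, unramified outside) with `res_v y − H¹(ι) x_v` in the signed local Kummer condition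
`twistedTorsionLocalKummer … K_v (A v)` at every `v ∣ p` outside `S₀`: Howard's `SelmerComplement` (i) for `𝓖^A_{S₀} ≤ 𝓖^A_{S₀ ∪ {v ∣ p}}`,
target `H¹(ι) x_v` at `v ∣ p` and `0` elsewhere, orthogonal to `H¹_{(𝓖^A_{S₀})^*}(K, M_{J'}^D)` by the adjunction
`⟨H¹(ι) x_v, y_v⟩_v = ⟨x_v, H¹(ι^D) y_v⟩_v` and `htower`. [cite: GreenbergLNM1716, §4 Prop. 4.13 Remark (p. 122), p. 124]
[cite: Howard2004HeegnerKolyvagin, Thm. 2.1.11 (arXiv:1202.6340 p. 6)] -/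
theorem exists_mem_selmerGroup_relaxed_sub_map_incl_mem_localKummer_of_poitouTate
    [hfin : ∀ J : ℕ, Finite (W.geomTorsion ((p ^ J : ℕ) : ℤ))]
    (hPT : poitouTate_selmerStructure_duality K)
    (hS : ∀ (J : ℕ) (v : HeightOneSpectrum (𝓞 K)), (Sum.inr v : Place K) ∉ twistedDescentPlaces (K := K) p S₀ →
      ((p ^ J : ℕ) : 𝓞 K) ∉ v.asIdeal ∧ GaloisRep.IsUnramifiedAt v (W.twistedTorsionGaloisModule p κ J u hu))
    (htower : ∀ J : ℕ, ∃ (J' : ℕ) (hJ : J ≤ J'), ∀ inv : LocalInvariants K (p ^ J'), inv.IsPerfect →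
      inv.SumLocalTermEqZero → inv.UnramifiedOrthogonal →
      ∀ y ∈ (inv.dualSelmerStructure (W.twistedTorsionGaloisModule p κ J' u hu)
          (W.twistedSignedRelaxedSelmerStructure p S₀ κ J' u hu A)).selmerGroup,
        galoisCohomology.map (W.twistedTorsionInclDual p κ hJ u hu) 1 y = 0)
    (J : ℕ) (x : ∀ v : HeightOneSpectrum (𝓞 K),
      galoisCohomology ((W.twistedTorsionGaloisModule p κ J u hu).restrictField (v.adicCompletion K)) 1) :
    ∃ (J' : ℕ) (hJ : J ≤ J') (y : galoisCohomology (W.twistedTorsionGaloisModule p κ J' u hu) 1),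
      y ∈ (W.twistedSignedRelaxedSelmerStructure p (S₀ ∪ WeierstrassCurve.placesAbove (K := K) p) κ J' u hu A).selmerGroup ∧
      ∀ v : HeightOneSpectrum (𝓞 K), ((p : ℕ) : 𝓞 K) ∈ v.asIdeal → v ∉ S₀ →
        galoisCohomology.res (W.twistedTorsionGaloisModule p κ J' u hu) (v.adicCompletion K) 1 y -
            galoisCohomology.map ((W.twistedTorsionIncl p κ hJ u hu).restrictField (v.adicCompletion K)) 1 (x v) ∈
          W.twistedTorsionLocalKummer p κ J' u hu (v.adicCompletion K) (A v) := by
  obtain ⟨J', hJ, hy⟩ := htower J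
  haveI : NeZero (p ^ J') := ⟨pow_ne_zero _ (Fact.out : p.Prime).ne_zero⟩
  obtain ⟨inv, hperf, hvan, hur, hSC⟩ := hPT (p ^ J')
  have hM : ∀ m : W.geomTorsion ((p ^ J' : ℕ) : ℤ), (p ^ J') • m = 0 := W.pow_nsmul_geomTorsion_pow p J'
  -- the target family: `H¹(ι) x_v` at `v ∣ p`, `0` elsewhere
  let t' : Π v : Place K, galoisCohomology ((W.twistedTorsionGaloisModule p κ J' u hu).toLocal v) 1 := fun v ↦
    match v with
    | Sum.inl _ => 0
    | Sum.inr v =>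
        if ((p : ℕ) : 𝓞 K) ∈ v.asIdeal then
          (galoisCohomology.map ((W.twistedTorsionIncl p κ hJ u hu).restrictField (Place.Completion (K := K) (Sum.inr v)))
            1 (x v) : galoisCohomology ((W.twistedTorsionGaloisModule p κ J' u hu).toLocal (Sum.inr v)) 1)
        else 0
  have ht'inl : ∀ w : InfinitePlace K, t' (Sum.inl w) = 0 := fun _ ↦ rfl
  have ht'inr : ∀ v : HeightOneSpectrum (𝓞 K), t' (Sum.inr v) = if ((p : ℕ) : 𝓞 K) ∈ v.asIdeal then
      (galoisCohomology.map ((W.twistedTorsionIncl p κ hJ u hu).restrictField (Place.Completion (K := K) (Sum.inr v)))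
        1 (x v) : galoisCohomology ((W.twistedTorsionGaloisModule p κ J' u hu).toLocal (Sum.inr v)) 1) else 0 :=
    fun _ ↦ rfl
  have ht' : ∀ v ∈ twistedDescentPlaces (K := K) p S₀,
      t' v ∈ W.twistedSignedRelaxedSelmerStructure p (S₀ ∪ WeierstrassCurve.placesAbove (K := K) p) κ J' u hu A v := by
    intro v hv
    cases v with
    | inl w => rw [W.twistedSignedRelaxedSelmerStructure_inl]; exact AddSubgroup.mem_top _
    | inr v =>
      have hv' : v ∈ S₀ ∪ WeierstrassCurve.placesAbove (K := K) p := by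
        rw [Finset.mem_union, WeierstrassCurve.mem_placesAbove_iff]
        exact (inr_mem_twistedDescentPlaces_iff p S₀ v).1 hv
      rw [W.twistedSignedRelaxedSelmerStructure_inr_of_mem p _ κ J' u hu A hv']; exact AddSubgroup.mem_top _
  -- orthogonality to the dual of `𝓖^A_{S₀}`: adjunction + the tower input
  have horth : ∀ y ∈ (inv.dualSelmerStructure (W.twistedTorsionGaloisModule p κ J' u hu)
      (W.twistedSignedRelaxedSelmerStructure p S₀ κ J' u hu A)).selmerGroup,
      ∑ v ∈ twistedDescentPlaces (K := K) p S₀,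
        localTatePairingZMod (W.twistedTorsionGaloisModule p κ J' u hu) (p ^ J') v (inv v) (t' v)
          (galoisCohomology.localization ((W.twistedTorsionGaloisModule p κ J' u hu).tateDual (p ^ J')) v 1 y) = 0 := by
    intro y hy'
    have hy0 := hy inv hperf hvan hur y hy'
    refine Finset.sum_eq_zero fun v _ ↦ ?_
    cases v with
    | inl w => rw [ht'inl, map_zero, AddMonoidHom.zero_apply]
    | inr v =>
      by_cases hpv : ((p : ℕ) : 𝓞 K) ∈ v.asIdeal
      · have hnat : galoisCohomology.map ((W.twistedTorsionInclDual p κ hJ u hu).restrictField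
              (Place.Completion (K := K) (Sum.inr v))) 1
            (galoisCohomology.localization ((W.twistedTorsionGaloisModule p κ J' u hu).tateDual (p ^ J'))
              (Sum.inr v) 1 y) =
            galoisCohomology.localization ((W.twistedTorsionGaloisModule p κ J u hu).tateDual (p ^ J')) (Sum.inr v) 1
              (galoisCohomology.map (W.twistedTorsionInclDual p κ hJ u hu) 1 y) :=
          (galoisCohomology.res_map_one _ _ y).symm
        rw [ht'inr, if_pos hpv, W.localTatePairingZMod_map_twistedTorsionIncl p κ hJ u hu (Sum.inr v) (inv (Sum.inr v)),
          hnat, hy0, map_zero, map_zero]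
      · have h0 : t' (Sum.inr v) = 0 := by rw [ht'inr, if_neg hpv]; rfl
        rw [h0, map_zero, AddMonoidHom.zero_apply]
  obtain ⟨y, hySel, hyt⟩ := (hSC (W.twistedTorsionGaloisModule p κ J' u hu) hM (twistedDescentPlaces (K := K) p S₀)
    (hS J') (W.twistedSignedRelaxedSelmerStructure p S₀ κ J' u hu A)
    (W.twistedSignedRelaxedSelmerStructure p (S₀ ∪ WeierstrassCurve.placesAbove (K := K) p) κ J' u hu A)
    (twistedSignedRelaxedSelmerStructure_le_union_placesAbove W p S₀ κ u hu A J')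
    (W.isUnramifiedOutside_twistedSignedRelaxedSelmerStructure p S₀ κ J' u hu A)
    (isUnramifiedOutside_twistedSignedRelaxedSelmerStructure_union_placesAbove W p S₀ κ u hu A J')).1 t' ht' horth
  refine ⟨J', hJ, y, hySel, fun v hpv hv ↦ ?_⟩
  have h := hyt (Sum.inr v) ((inr_mem_twistedDescentPlaces_iff p S₀ v).2 (Or.inr hpv))
  rw [ht'inr, if_pos hpv, W.twistedSignedRelaxedSelmerStructure_inr_of_mem_asIdeal p S₀ κ J' u hu A hv hpv] at h
  exact h

end General

/-! ## §2. `K = ℚ`, cyclotomic `κ`, `v ∋ p`: the signed Kummer condition over `ℚ_∞` holds for all conjugates -/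

section Rat

variable (W : WeierstrassCurve ℚ) {p : ℕ} [Fact p.Prime] (κ : ZpExtension ℚ p)

/-- **At `v ∋ p`, for the cyclotomic tower, Kobayashi's signed Kummer condition over `ℚ_∞` is stable under every `conj_σ`,
`σ ∈ Γ_ℚ`**: `σ = res(d)·h` with `d ∈ Γ_{ℚ_v}`, `h ∈ ker κ` (`exists_resGal_inv_mul_mem_kerSubgroup` — the place above `p` is totally
ramified), `conj_h = id`, and `conj_{res d}` preserves the condition because `⨆ₙ E^ε(ℚ_{n,v})` is `Γ_{ℚ_v}`-stable
(`conjH1_mem_localKummerOverOfEmb_of_smul_mem`, `smul_mem_iSup_signedLocalPoints`). [cite: Kobayashi2003, Def. 1.1, Prop. 8.12 i)]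
[cite: SerreLocalFields1979, VII §5 Prop. 3] -/
theorem conjH1_mem_localKummerOverOfEmb_iSup_signedLocalPoints (hκ : κ.IsCyclotomic) (v : HeightOneSpectrum (𝓞 ℚ))
    (hv : ((p : ℕ) : 𝓞 ℚ) ∈ v.asIdeal) (ε : ℤˣ) {c : W.subgroupH1 p κ.kerSubgroup}
    (hc : c ∈ localKummerOverOfEmb W p κ.kerSubgroup (closureEmb (K := ℚ) (v.adicCompletion ℚ))
      (⨆ n : ℕ, signedLocalPoints κ (v.adicCompletion ℚ) W ε n)) (σ : Field.absoluteGaloisGroup ℚ) :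
    W.conjH1 p κ.kerSubgroup σ c ∈ localKummerOverOfEmb W p κ.kerSubgroup (closureEmb (K := ℚ) (v.adicCompletion ℚ))
      (⨆ n : ℕ, signedLocalPoints κ (v.adicCompletion ℚ) W ε n) := by
  obtain ⟨d, hd⟩ := Summit.BirchSwinnertonDyer.Rank1Residual.X1.LocalKerOverAtPConj.exists_resGal_inv_mul_mem_kerSubgroup κ hκ hv σ
  have hσ : σ = resGal (K := ℚ) (v.adicCompletion ℚ) d * ((resGal (K := ℚ) (v.adicCompletion ℚ) d)⁻¹ * σ) := by
    rw [mul_inv_cancel_left]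
  rw [hσ, W.conjH1_mul_holds p κ.kerSubgroup, AddMonoidHom.comp_apply, W.conjH1_of_mem_holds p κ.kerSubgroup hd,
    AddMonoidHom.id_apply]
  exact SignedKatoOffTwo.KummerPoint.conjH1_mem_localKummerOverOfEmb_of_smul_mem W p κ
    (closureEmb (K := ℚ) (v.adicCompletion ℚ)) _ d
    (fun a ha ↦ SignedKatoOffTwo.KummerPoint.smul_mem_iSup_signedLocalPoints W κ _ ε d ha) hc

/-- **The `⨅_σ` of road T's `K₂⁺` costs nothing over `ℚ`**: a class in the signed Kummer condition at every `v ∋ p` lies in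
`⨅_{v ∋ p} ⨅_σ conj_σ⁻¹(signed Kummer condition at v)`. [cite: Kobayashi2003, Def. 1.1] [cite: SerreLocalFields1979, VII §5 Prop. 3] -/
theorem mem_iInf_comap_conjH1_localKummer_of_forall_mem (hκ : κ.IsCyclotomic) (ε : ℤˣ) {c : W.subgroupH1 p κ.kerSubgroup}
    (hc : ∀ v : HeightOneSpectrum (𝓞 ℚ), ((p : ℕ) : 𝓞 ℚ) ∈ v.asIdeal →
      c ∈ localKummerOverOfEmb W p κ.kerSubgroup (closureEmb (K := ℚ) (v.adicCompletion ℚ))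
        (⨆ n : ℕ, signedLocalPoints κ (v.adicCompletion ℚ) W ε n)) :
    c ∈ ⨅ (v : HeightOneSpectrum (𝓞 ℚ)) (_ : ((p : ℕ) : 𝓞 ℚ) ∈ v.asIdeal) (σ : Field.absoluteGaloisGroup ℚ),
      (localKummerOverOfEmb W p κ.kerSubgroup (closureEmb (K := ℚ) (v.adicCompletion ℚ))
        (⨆ n : ℕ, signedLocalPoints κ (v.adicCompletion ℚ) W ε n)).comap (W.conjH1 p κ.kerSubgroup σ) := by
  refine AddSubgroup.mem_iInf.2 fun v ↦ AddSubgroup.mem_iInf.2 fun hv ↦ AddSubgroup.mem_iInf.2 fun σ ↦ ?_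
  rw [AddSubgroup.mem_comap]
  exact conjH1_mem_localKummerOverOfEmb_iSup_signedLocalPoints W κ hκ v hv ε (hc v hv) σ

end Rat

end Summit.BirchSwinnertonDyer.BirchSwinnertonDyer.Theorems.SignedEC.TwistedPT

end
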